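import Mathlib
import Summits.KontsevichZagierPeriods.Zeta5Search.ClassTypeGuards
import HarnessLib

/-!
# ζ(5) search — RAY FACE KIT I: a kernel-checkable FACE CERTIFICATE for class-type covers on an integer-slope ray (P1 g14)

HONEST FRAMING: systematic search; no irrationality claim unless certified.  Cell `pub-zeta5`, prover seat P1, generation 14.
Integer bookkeeping of net exponents; every kernel exponent the consumers feed stays `< 1` — no irrationality content; nothing
about `ζ(5)`.

The machine-generated class-type covers of the window files `RayC1Letters*` (P1 g13 on p3 g6's machine) prove, residue interval by
residue interval and LEVEL BY LEVEL (one `omega` per level), that the class of `x (mod p)` of the ray vector `b(n)` has a constant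
level type on each interval.  This file replaces the level-by-level proofs by ONE certificate check.  On a ray whose net exponents
are an indicator sum over blocks `[lo_j·n, hi_j·n]` plus the even-centre term (`NetExpBlocks`), the level type of the class of `x` is
determined by the CROSSING LEVELS `K` of the block end points and by the ORDER of the integer affine CUTS
`lo_j·n − (K−1)·p`, `hi_j·n + 1 − (K−1)·p`, the top cut `B₀·n − Λ·p + 1` and the centre point; on a `θ`-face (a wedge
`a₁n ≤ a₂p`, `b₂p ≤ b₁n`, `n ≥ N₀`, fixed parity of `n`) the order is constant and is verified by an integer test per adjacent pair in the half-lattice variables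
`n = 2n' + r`, `p = 2p' + 1` (`LWedge.nonneg`: two recession slopes, one vertex).  §1 affine forms, the wedge test
(`LWedge.nonneg_sound`) and the window-to-wedge substitution (`Window.holds_lwedge`);
§2 certificates (`Cut`, `FaceCert`), thresholds, the checker `faceCheck` and the computed cover `coverOf`; §3 the crossing
lemma `cross_iff` (when does the level `x + k·p` pass a block end point).  File II (`RayFaceKitCover`) proves
`faceCheck … = true → Cover (b n) p (coverOf …)`.
-/

namespace Summit.KontsevichZagierPeriods.Zeta5Search.RayFaceKit

open Summit.KontsevichZagierPeriods.Zeta5Search.ClusterValuation (netExp)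

/-! ## §1 Integer affine forms on a lattice wedge -/

/-- Integer affine form `u·n + v·p + w` in two variables. -/
structure Aff where
  /-- coefficient of the first variable -/
  u : ℤ
  /-- coefficient of the second variable -/
  v : ℤ
  /-- constant -/
  w : ℤ
deriving DecidableEq

/-- Value of an affine form at `(n, p)`. -/
def Aff.eval (f : Aff) (n p : ℕ) : ℤ := f.u * n + f.v * p + f.w

/-- Difference of affine forms. -/
def Aff.sub (f g : Aff) : Aff := ⟨f.u - g.u, f.v - g.v, f.w - g.w⟩

/-- Evaluation of a difference. -/
theorem Aff.eval_sub (f g : Aff) (n p : ℕ) : (f.sub g).eval n p = f.eval n p - g.eval n p := by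
  simp only [Aff.eval, Aff.sub]; ring

/-- Half-lattice substitution `n = 2n' + r`, `p = 2p' + 1`: the same form in the variables `(n', p')`. -/
def Aff.half (f : Aff) (r : ℕ) : Aff := ⟨2 * f.u, 2 * f.v, f.u * r + f.v + f.w⟩

/-- The half-lattice substitution preserves values. -/
theorem Aff.eval_half (f : Aff) {r n p n' p' : ℕ} (hn : n = 2 * n' + r) (hp : p = 2 * p' + 1) :
    f.eval n p = (f.half r).eval n' p' := by
  simp only [Aff.eval, Aff.half, hn, hp]; push_cast; ring

/-- The half-lattice substitution is additive. -/
theorem Aff.half_sub (f g : Aff) (r : ℕ) : (f.sub g).half r = (f.half r).sub (g.half r) := by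
  simp only [Aff.half, Aff.sub, Aff.mk.injEq]; refine ⟨by ring, by ring, by ring⟩

/-- A lattice wedge: `a₁·m + gₐ ≤ a₂·q`, `b₂·q + g_b ≤ b₁·m`, `N₀ ≤ m`. -/
structure LWedge where
  /-- left edge slope numerator -/
  a1 : ℕ
  /-- left edge slope denominator -/
  a2 : ℕ
  /-- right edge slope numerator -/
  b1 : ℕ
  /-- right edge slope denominator -/
  b2 : ℕ
  /-- left edge offset -/
  ga : ℤ
  /-- right edge offset -/
  gb : ℤ
  /-- floor for the first variable -/
  N0 : ℕ
deriving DecidableEq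

/-- Membership of `(m, q)` in the lattice wedge. -/
def LWedge.Mem (W : LWedge) (m q : ℕ) : Prop :=
  W.N0 ≤ m ∧ (W.a1 : ℤ) * m + W.ga ≤ (W.a2 : ℤ) * q ∧ (W.b2 : ℤ) * q + W.gb ≤ (W.b1 : ℤ) * m

/-- Sufficient integer test for `f ≥ 0` on the wedge: both recession slopes `≥ 0`, and the relevant vertex at `m = N₀` (on the left
edge if the `q`-coefficient is `≥ 0`, else on the right edge). -/
def LWedge.nonneg (W : LWedge) (f : Aff) : Bool :=
  decide (0 < W.a2) && decide (0 < W.b2) &&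
    decide (0 ≤ f.u * W.a2 + f.v * W.a1) && decide (0 ≤ f.u * W.b2 + f.v * W.b1) &&
    (if 0 ≤ f.v then decide (0 ≤ (f.u * W.a2 + f.v * W.a1) * W.N0 + W.a2 * f.w + f.v * W.ga)
      else decide (0 ≤ (f.u * W.b2 + f.v * W.b1) * W.N0 + W.b2 * f.w - f.v * W.gb))

/-- **Soundness of the wedge test.** -/
theorem LWedge.nonneg_sound {W : LWedge} {f : Aff} (h : W.nonneg f = true) {m q : ℕ} (hm : W.Mem m q) :
    0 ≤ f.eval m q := by
  obtain ⟨hN, hA, hB⟩ := hm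
  simp only [LWedge.nonneg, Bool.and_eq_true, decide_eq_true_eq] at h
  obtain ⟨⟨⟨⟨ha2, hb2⟩, hs1⟩, hs2⟩, hv⟩ := h
  have hN' : (W.N0 : ℤ) ≤ m := by exact_mod_cast hN
  unfold Aff.eval
  split_ifs at hv with hsgn
  · rw [decide_eq_true_eq] at hv
    have h1 : f.v * ((W.a1 : ℤ) * m + W.ga) ≤ f.v * ((W.a2 : ℤ) * q) := mul_le_mul_of_nonneg_left hA hsgn
    have h2 : (f.u * W.a2 + f.v * W.a1) * (W.N0 : ℤ) ≤ (f.u * W.a2 + f.v * W.a1) * (m : ℤ) :=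
      mul_le_mul_of_nonneg_left hN' hs1
    have h3 : 0 ≤ (W.a2 : ℤ) * (f.u * m + f.v * q + f.w) := by nlinarith
    have ha2' : (0 : ℤ) < W.a2 := by exact_mod_cast ha2
    by_contra hcon
    push Not at hcon
    nlinarith [h3, ha2', hcon]
  · rw [decide_eq_true_eq] at hv
    push Not at hsgn
    have h1 : f.v * ((W.b1 : ℤ) * m) ≤ f.v * ((W.b2 : ℤ) * q + W.gb) := mul_le_mul_of_nonpos_left hB hsgn.le
    have h2 : (f.u * W.b2 + f.v * W.b1) * (W.N0 : ℤ) ≤ (f.u * W.b2 + f.v * W.b1) * (m : ℤ) :=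
      mul_le_mul_of_nonneg_left hN' hs2
    have h3 : 0 ≤ (W.b2 : ℤ) * (f.u * m + f.v * q + f.w) := by nlinarith
    have hb2' : (0 : ℤ) < W.b2 := by exact_mod_cast hb2
    by_contra hcon
    push Not at hcon
    nlinarith [h3, hb2', hcon]

/-- Chain test: consecutive differences of a list of forms are `≥ 0` on the wedge. -/
def LWedge.chain (W : LWedge) : List Aff → Bool
  | [] => true
  | [_] => true
  | f :: g :: l => W.nonneg (g.sub f) && LWedge.chain W (g :: l)

/-- Soundness of the chain test: the values are monotone along the list. -/
theorem LWedge.chain_sound {W : LWedge} {m q : ℕ} (hm : W.Mem m q) :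
    ∀ {l : List Aff}, W.chain l = true → ∀ i j, i ≤ j → j < l.length →
      (l.getD i ⟨0, 0, 0⟩).eval m q ≤ (l.getD j ⟨0, 0, 0⟩).eval m q
  | [], _, i, j, _, hj => absurd hj (Nat.not_lt_zero j)
  | [f], _, i, j, hij, hj => by
      have hj0 : j = 0 := by simpa using hj
      subst hj0
      have hi0 : i = 0 := Nat.le_zero.mp hij
      subst hi0; exact le_rfl
  | f :: g :: l, h, i, j, hij, hj => by
      simp only [LWedge.chain, Bool.and_eq_true] at h
      obtain ⟨hfg, hrest⟩ := h
      have hfg' : f.eval m q ≤ g.eval m q := by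
        have := LWedge.nonneg_sound hfg hm
        rw [Aff.eval_sub] at this; linarith
      rcases Nat.eq_zero_or_pos i with hi | hi
      · subst hi
        rcases Nat.eq_zero_or_pos j with hj0 | hj0
        · subst hj0; exact le_rfl
        · have ih := LWedge.chain_sound hm (l := g :: l) hrest 0 (j - 1) (Nat.zero_le _)
            (by simp only [List.length_cons] at hj ⊢; omega)
          obtain ⟨j', rfl⟩ : ∃ j', j = j' + 1 := ⟨j - 1, by omega⟩
          simp only [List.getD_cons_zero, List.getD_cons_succ, Nat.add_sub_cancel] at ih ⊢
          exact le_trans hfg' ih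
      · obtain ⟨i', rfl⟩ : ∃ i', i = i' + 1 := ⟨i - 1, by omega⟩
        obtain ⟨j', rfl⟩ : ∃ j', j = j' + 1 := ⟨j - 1, by omega⟩
        simp only [List.getD_cons_succ]
        exact LWedge.chain_sound hm (l := g :: l) hrest i' j' (by omega) (by simp only [List.length_cons] at hj ⊢; omega)

/-- A window of the ray: `θ = p/n ∈ (a₁/a₂, b₁/b₂)` (open), `n ≥ N₀`, parity `n ≡ r (mod 2)`; `p` odd. -/
structure Window where
  /-- left end `a₁/a₂ < θ` -/
  a1 : ℕ
  /-- left end denominator -/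
  a2 : ℕ
  /-- right end `θ < b₁/b₂` -/
  b1 : ℕ
  /-- right end denominator -/
  b2 : ℕ
  /-- floor for `n` -/
  N0 : ℕ
  /-- parity of `n` -/
  r : ℕ
deriving DecidableEq

/-- `(n, p)` lies in the window. -/
def Window.Holds (w : Window) (n p : ℕ) : Prop :=
  w.N0 ≤ n ∧ w.a1 * n + 1 ≤ w.a2 * p ∧ w.b2 * p + 1 ≤ w.b1 * n ∧ n % 2 = w.r ∧ p % 2 = 1

/-- Round an integer up to an even one. -/
def evenUp (z : ℤ) : ℤ := z + z % 2

/-- The lattice wedge of a window in the half-lattice variables `n' = ⌊n/2⌋`, `p' = ⌊p/2⌋`. -/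
def Window.lwedge (w : Window) : LWedge :=
  ⟨2 * w.a1, 2 * w.a2, 2 * w.b1, 2 * w.b2, evenUp ((w.a1 * w.r : ℕ) + 1 - w.a2), evenUp ((w.b2 : ℤ) + 1 - (w.b1 * w.r : ℕ)),
    (w.N0 + 1 - w.r) / 2⟩

/-- A point of the window is a point of its lattice wedge in the half-lattice variables. -/
theorem Window.holds_lwedge {w : Window} {n p : ℕ} (h : w.Holds n p) :
    w.lwedge.Mem (n / 2) (p / 2) ∧ n = 2 * (n / 2) + w.r ∧ p = 2 * (p / 2) + 1 := by
  obtain ⟨hN, hA, hB, hr, hp⟩ := h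
  have hn : n = 2 * (n / 2) + w.r := by omega
  have hp' : p = 2 * (p / 2) + 1 := by omega
  refine ⟨⟨by simp only [Window.lwedge]; omega, ?_, ?_⟩, hn, hp'⟩
  · have hA' : (w.a1 : ℤ) * n + 1 ≤ (w.a2 : ℤ) * p := by exact_mod_cast hA
    set n' := n / 2
    set p' := p / 2
    have hnz : (n : ℤ) = 2 * (n' : ℤ) + w.r := by exact_mod_cast hn
    have hpz : (p : ℤ) = 2 * (p' : ℤ) + 1 := by exact_mod_cast hp'
    rw [hnz, hpz] at hA'
    have hD : (w.a1 : ℤ) * w.r + 1 - w.a2 ≤ 2 * ((w.a2 : ℤ) * p' - (w.a1 : ℤ) * n') := by linarith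
    have hE : evenUp ((w.a1 : ℤ) * w.r + 1 - w.a2) ≤ 2 * ((w.a2 : ℤ) * p' - (w.a1 : ℤ) * n') := by
      unfold evenUp; omega
    simp only [Window.lwedge]; push_cast; linarith
  · have hB' : (w.b2 : ℤ) * p + 1 ≤ (w.b1 : ℤ) * n := by exact_mod_cast hB
    set n' := n / 2
    set p' := p / 2
    have hnz : (n : ℤ) = 2 * (n' : ℤ) + w.r := by exact_mod_cast hn
    have hpz : (p : ℤ) = 2 * (p' : ℤ) + 1 := by exact_mod_cast hp'
    rw [hnz, hpz] at hB'
    have hD : (w.b2 : ℤ) + 1 - (w.b1 : ℤ) * w.r ≤ 2 * ((w.b1 : ℤ) * n' - (w.b2 : ℤ) * p') := by linarith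
    have hE : evenUp ((w.b2 : ℤ) + 1 - (w.b1 : ℤ) * w.r) ≤ 2 * ((w.b1 : ℤ) * n' - (w.b2 : ℤ) * p') := by
      unfold evenUp; omega
    simp only [Window.lwedge]; push_cast; linarith

/-! ## §2 Cuts, face certificates, the checker and the computed cover -/

/-- The kind of a cut of the residue range `[0, p)`: the lower end of block `j` (`q ≥ lo_j·n`), the upper end of block `j`
(`q ≥ hi_j·n + 1`), the top (`x + Λp > B₀ n`), and the two sides of the centre point (`2x = B₀n − L p`). -/
inductive Kind
  | lo (j : ℕ)
  | hi (j : ℕ)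
  | top
  | cenLo
  | cenHi
deriving DecidableEq

/-- A cut: its kind and its crossing level `K` (for `lo`/`hi`: the level at which the class of `x = 0⁺` passes the end point;
for `top`: `Λ = ⌊B₀n/p⌋`; ignored for the centre cuts). -/
structure Cut where
  /-- which end point -/
  kind : Kind
  /-- crossing level -/
  K : ℕ
deriving DecidableEq

/-- A face certificate: the window (with floor and parity) and the cuts IN INCREASING ORDER of position. -/
structure FaceCert where
  /-- the window -/
  win : Window
  /-- the ordered cuts -/
  cuts : List Cut
deriving DecidableEq

/-- Indices of the cuts of a given kind. -/
def idxs (cs : List Cut) (κ : Kind) : List ℕ := (List.range cs.length).filter fun i => (cs.getD i ⟨.top, 0⟩).kind = κ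

/-- The (first) index of the cut of kind `κ` (`cs.length` if absent). -/
def idx (cs : List Cut) (κ : Kind) : ℕ := (idxs cs κ).headD cs.length

/-- The crossing level recorded at the cut of kind `κ`. -/
def levelK (cs : List Cut) (κ : Kind) : ℕ := (cs.getD (idx cs κ) ⟨.top, 0⟩).K

/-- Side bit (as `0/1`): interval `j` is past the cut of kind `κ` iff the cut's index is `< j`. -/
def pastN (cs : List Cut) (κ : Kind) (j : ℕ) : ℕ := if idx cs κ < j then 1 else 0

/-- The side bit is `0` or `1`. -/
theorem pastN_le_one (cs : List Cut) (κ : Kind) (j : ℕ) : pastN cs κ j ≤ 1 := by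
  unfold pastN; split_ifs <;> simp

/-- Interval `j` is the centre class: past `cenLo`, not past `cenHi`. -/
def cenOf (cs : List Cut) (j : ℕ) : Bool := decide (idx cs .cenLo < j) && !decide (idx cs .cenHi < j)

/-- Indicator of block `jb` at level `k` of interval `j`: the level has passed `lo_jb·n` and not yet `hi_jb·n + 1`. -/
def blockOn (cs : List Cut) (j jb k : ℕ) : Bool :=
  decide (levelK cs (.lo jb) ≤ k + pastN cs (.lo jb) j) && !decide (levelK cs (.hi jb) ≤ k + pastN cs (.hi jb) j)

/-- `Λ` of the intervals past the top cut is `Ktop − 1`, else `Ktop`; interval `j` is past cut `i` iff `i < j`. -/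
def lam (cs : List Cut) (j : ℕ) : ℕ := levelK cs .top - pastN cs .top j

/-- `L` of the centre class: `Λ` of the interval just past `cenLo`. -/
def lamC (cs : List Cut) : ℕ := lam cs (idx cs .cenLo + 1)

/-- The DOUBLED threshold of a cut as an affine form: `x` is past the cut iff `threshold ≤ 2x`. -/
def thr (B0 : ℕ) (los his : List ℕ) (cs : List Cut) (c : Cut) : Aff :=
  match c.kind with
  | .lo j => ⟨2 * (los.getD j 0 : ℤ), -(2 * ((c.K : ℤ) - 1)), 0⟩
  | .hi j => ⟨2 * (his.getD j 0 : ℤ), -(2 * ((c.K : ℤ) - 1)), 2⟩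
  | .top => ⟨2 * (B0 : ℤ), -(2 * (c.K : ℤ)), 2⟩
  | .cenLo => ⟨(B0 : ℤ), -(lamC cs : ℤ), 0⟩
  | .cenHi => ⟨(B0 : ℤ), -(lamC cs : ℤ), 2⟩

/-- The full threshold chain: `0`, the cuts in order, `2p`. -/
def chainList (B0 : ℕ) (los his : List ℕ) (cs : List Cut) : List Aff :=
  ⟨0, 0, 0⟩ :: (cs.map (thr B0 los his cs) ++ [⟨0, 2, 0⟩])


/-- Number of blocks containing level `k` of interval `j` (recursion on the block count `J`). -/
def depth (cs : List Cut) (j k : ℕ) : ℕ → ℕ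
  | 0 => 0
  | J + 1 => depth cs j k J + (if blockOn cs j J k then 1 else 0)

/-- Net exponent at level `k` of interval `j`: `1 − depth + [centre level]`. -/
def entry (J : ℕ) (cs : List Cut) (j k : ℕ) : ℤ :=
  1 - (depth cs j k J : ℤ) + (if cenOf cs j && decide (2 * k = lam cs j) then 1 else 0)

/-- The level type of interval `j`. -/
def word (J : ℕ) (cs : List Cut) (j : ℕ) : List ℤ := (List.range (lam cs j + 1)).map (entry J cs j)

/-- **The computed cover**: one (type, centre flag) per interval `j = 0 … #cuts`. -/
def coverOf (J : ℕ) (c : FaceCert) : List (List ℤ × Bool) :=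
  (List.range (c.cuts.length + 1)).map fun j => (word J c.cuts j, cenOf c.cuts j)

/-- Every kind of cut needed for `J` blocks occurs exactly once. -/
def kindsOK (J : ℕ) (cs : List Cut) : Bool :=
  decide ((idxs cs .top).length = 1) && decide ((idxs cs .cenLo).length = 1) && decide ((idxs cs .cenHi).length = 1) &&
    (List.range J).all fun jb => decide ((idxs cs (.lo jb)).length = 1) && decide ((idxs cs (.hi jb)).length = 1)

/-- **The face checker**: kinds complete, the centre cuts adjacent, `Ktop ≥ 1`, the centre class has an integral centre
(`B₀ r + L_c` even), `r ≤ 1`, and the threshold chain is monotone on the lattice wedge of the window (half-lattice variables). -/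
def faceCheck (B0 J : ℕ) (los his : List ℕ) (c : FaceCert) : Bool :=
  kindsOK J c.cuts && decide (idx c.cuts .cenHi = idx c.cuts .cenLo + 1) && decide (1 ≤ levelK c.cuts .top) &&
    decide ((B0 * c.win.r + lamC c.cuts) % 2 = 0) && decide (c.win.r ≤ 1) &&
    c.win.lwedge.chain ((chainList B0 los his c.cuts).map fun f => f.half c.win.r)

/-! ## §3 The crossing lemma -/

/-- **Crossing lemma.** If the cut `c = m − (K−1)p` of an end point `m` lies in `[0, p]`, then the level `x + kp` of a
residue `x ∈ [0, p)` has passed `m` iff `K ≤ k` (for `x` before the cut) resp. `K ≤ k + 1` (for `x` past the cut). -/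
theorem cross_iff {m c x p : ℤ} {K k s : ℕ} (hc : c = m - ((K : ℤ) - 1) * p) (h0 : 0 ≤ c) (hcp : c ≤ p)
    (hx0 : 0 ≤ x) (hxp : x < p) (hs1 : s ≤ 1) (hpast : s = 1 → c ≤ x) (hbefore : s = 0 → x < c) :
    m ≤ x + k * p ↔ (K : ℤ) ≤ k + s := by
  have hp : 0 < p := by linarith
  rcases (by omega : s = 0 ∨ s = 1) with rfl | rfl
  · have hs := hbefore rfl
    push_cast; simp only [add_zero]
    constructor
    · intro h
      -- `(K-1)p = m - c < m - x ≤ kp`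
      have h1 : ((K : ℤ) - 1) * p < (k : ℤ) * p := by linarith
      have h2 : (K : ℤ) - 1 < k := lt_of_mul_lt_mul_right h1 hp.le
      linarith
    · intro h
      have h1 : (K : ℤ) * p ≤ (k : ℤ) * p := mul_le_mul_of_nonneg_right h hp.le
      nlinarith
  · have hs := hpast rfl
    push_cast
    constructor
    · intro h
      have h1 : ((K : ℤ) - 1) * p < ((k : ℤ) + 1) * p := by nlinarith
      have h2 : (K : ℤ) - 1 < k + 1 := lt_of_mul_lt_mul_right h1 hp.le
      linarith
    · intro h
      have h1 : ((K : ℤ) - 1) * p ≤ (k : ℤ) * p := mul_le_mul_of_nonneg_right (by linarith) hp.le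
      nlinarith

end Summit.KontsevichZagierPeriods.Zeta5Search.RayFaceKit
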